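import Mathlib
import Literature.Analysis.FluidPDE.TaoCascadeBlowupDynamics
import Literature.Analysis.FluidPDE.FluidComputerGadget
import HarnessLib

/-!
# Tao 2016 ↔ the fluid-computer spec sheet: Prop. 6.3 read as a `GadgetSpec` (the dictionary, kernel-checked)

T. Tao, *Finite time blowup for an averaged three-dimensional Navier–Stokes equation*, J. Amer.
Math. Soc. **29** (2016) 601–674 = arXiv:1402.0290v3, §6.2 Prop. 6.3 (blow-up dynamics),
(6.9)–(6.25), and the paragraph after it (p. 32). [`Tao2016AveragedNS`]

HONEST FRAMING (cell pub-fluidc): this file is part of a low prior, high value-of-information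
experiment on Tao's machine paradigm; NOT a claim that NS blows up. Everything below is about the
AVERAGED equation's cascade ODE (Tao's theorems, in tree) and elementary real arithmetic; nothing is
asserted about the true Navier–Stokes equations.

## What this file is

The cell's `SPEC-SHEET.md` §3 has a column "Tao 2016 (λ = 1+ε₀)": the values of the gadget-interface
keys `lam, alpha, Cplus, eta, leak, radius, …` (= the fields of
`Literature.Analysis.FluidPDE.FluidComputer.GadgetSpec`, file `FluidComputerGadget.lean`) that Tao's
averaged cascade ACHIEVES, read off Prop. 6.3. Until now that column was a prose cross-check
(`DICTIONARY.md`, `SPEC-INPUT-bp1.md` of the cell). Here it is a definition plus theorems: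

* `taoSpec ε₀ K n₀ : GadgetSpec` — the Tao column: `s = 1+ε₀`, `k0 = (1+ε₀)^{n₀}`,
  `alpha = 249/100 = 5/2 - 1/100`, `Cplus = 100·(1+ε₀)^{-n₀/100}`, `eta = (1+ε₀)^{-1/50}`,
  `leak = K^{-30}(1+ε₀)^{-10}`, `radius = K^{-10}`, and the READINGS `amp = 0`, `dStar = 0` (see
  "Design choices");
* the spec inequalities of SPEC-SHEET §2 hold for it: `taoSpec_valid` (sign conditions),
  `taoSpec_two_lt_alpha` ((B): `alpha > 2`, viscosity level-uniformly perturbative),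
  `taoSpec_inv_s_lt_eta` and `taoSpec_two_lt_alphaEff` ((D): `eta > 1/s ⟺ alphaEff > 2`, via
  `GadgetSpec.two_lt_alphaEff_iff`), `taoSpec_one_lt_cube_mul_eta` ((E): the sup² floor grows),
  `taoSpec_closure` ((C), in the degenerate reading `amp = dStar = 0`);
* THE DICTIONARY THEOREMS: if `t, e : ℤ → ℝ` are checkpoint times / amplitudes obeying the conclusion
  (6.9)–(6.25) of Prop. 6.3 up to level `N` (`TaoCascade.BlowupCheckpoints ε₀ K ε n₀ N X E t e`, in
  tree, file `TaoCascadeBlowupDynamics.lean`), then, with `σ = taoSpec ε₀ K n₀` and level `m` of the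
  spec sheet = Tao's scale `n₀ + m`:
  - `transferTime_le_Tmax`: `t_{n+1} - t_n ≤ σ.Tmax m` — the transfer-time law `T_m ≤ Cplus·k_m^{-alpha}`
    with `alpha = 249/100` ((6.12) upper lifespan + the amplitude drift `e_n ≥ (1+ε₀)^{-(n-n₀)/100}`);
    `lifespan_ge_geometric` is the matching lower envelope ((6.12) lower + `e_n ≤ (1+ε₀)^{(n-n₀)/100}`);
  - `eta_mul_sq_le_sq` / `sq_le_sq_div_eta`: `eta·e_n² ≤ e_{n+1}² ≤ e_n²/eta` — per-level energy
    efficiency at least `eta = (1+ε₀)^{-1/50}` ((6.11) amplitude stability, squared);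
    `eta_pow_le_sq`: the energy ladder `eta^m ≤ e_{n₀+m}²` (`E_m ≥ eta^m E_0` with `e_{n₀} = 1`, (6.10));
  - `forwardLeak_le`: during the step `n-1 → n` the energy one level BEYOND the output is
    `E_{n+1}(t) ≤ leak · e_{n-1}²` ((6.25) with `m = 1`);
  - `conduit_residual_le`: `|X_{4,n}(t_n)| ≤ radius · e_n` ((6.17));
  - `checkpoint_le_horizon`: `0 ≤ t_n ≤ σ.horizon` — Tao's "`t_N ≤ T_{ε₀}` independent of `N`" (p. 32)
    IS the spec sheet's finite horizon `Cplus·k0^{-alpha}/(1 - s^{-alpha})` ((A)), on the nose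
    (`taoSpec_horizon`);
  - `blowupDynamics_onSpec`: the same conclusions under the quantifier prefix of the named fact
    `TaoCascade.blowupDynamics` (Prop. 6.3 itself; not asserted — taken as a hypothesis).

So the "Tao instance" of the spec sheet is no longer a transcription: `alpha_Tao = 5/2 - 1/100 > 2`,
`eta_Tao·lam = (1+ε₀)^{49/50} > 1`, summable transfer times with the printed horizon, leakage
`K^{-30}(1+ε₀)^{-10}` — each is a theorem about the in-tree typing of Prop. 6.3, in the vocabulary
the cell's scorer measures true-NS candidates against.

## Design choices (see also the cell's DIVERGENCE.md)

* LEVEL INDEXING. The spec sheet counts levels `m = 0, 1, 2, …` from the seed; Tao's scales are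
  `n ∈ ℤ`, `n ≥ n₀`. Dictionary: `m ↦ n = n₀ + m`, `k_m = k0·s^m = (1+ε₀)^{n₀+m}` = the frequency
  `(1+ε₀)^n` of scale `n` (Def. 3.1 / (4.1)); `taoSpec_k`.
* WHICH ENERGY. The spec's "level energy" is matched with `e_n²`, the squared checkpoint amplitude
  `X_{1,n}(t_n) = e_n` ((6.13)); Tao's combined energies `E_n(t)` obey `E_{n-1}+E_n ≤ e_{n-1}²` during
  the step ((6.24)), so `e_n²` is the natural per-level energy unit (his energy is `½|X|²`; factor 2
  immaterial, only ratios enter).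
* `alpha = 249/100`, NOT `5/2`: the deterministic envelope of the lifespan (6.12) must absorb the
  amplitude drift (6.11), `e_n ∈ (1+ε₀)^{∓(n-n₀)/100}`; the printed proof of Thm. 6.2 (p. 32) makes
  exactly this bookkeeping (`(1+ε₀)^{-5n/2}·(1+ε₀)^{(n-n₀)/100}`, cf. the in-tree
  `TaoCascade.BlowupCheckpoints.time_le`). SPEC-SHEET §3 records "`alpha ≥ 5/2 - 1/100`".
* `amp = 0`, `dStar = 0` are a READING, not theorems of the paper: Prop. 6.4 reproduces the FIXED
  tolerances (6.13)–(6.18) level after level (no accumulated noise — the affine recursion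
  `eta·x' ≤ amp·x + leak + dStar` of SPEC-SHEET §2 (C) degenerates), and dissipation sits inside the
  `O((1+ε₀)^{-n₀/2})`-type error terms of Lemma 4.1 / (6.1)–(6.4) rather than in a per-step
  allowance. `radius = K^{-10}` is the CONDUIT tolerance (6.17) only; the trigger tolerances (6.14),
  (6.15) (`10⁻⁵ε`, `10⁻⁵e^{-K^{10}}ε²`) are mode-dependent and far smaller — one scalar radius cannot
  carry them (SPEC-SHEET §3 row `radius`: "MODE-dependent"). `taoSpec_closure` is therefore the
  trivial closure of the degenerate recursion and is flagged as such.
* Nothing here depends on `ε`, `C₁`, `C₂`, `X`, `E` beyond their appearance in `BlowupCheckpoints`;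
  `K > 0` (resp. `K ≥ 1`) is needed only for `radius > 0` (resp. the closure inequality).

## References
* T. Tao, JAMS 29 (2016) 601–674, arXiv:1402.0290v3: §6.2 Prop. 6.3 (6.9)–(6.25); p. 32 ("summing the
  geometric series … `t_N ≤ T`"). [`Tao2016AveragedNS`]
* Cell pub-fluidc: `SPEC-SHEET.md` §2 (A)–(E), §3 (column "Tao 2016"); `DICTIONARY.md` §1–2.
-/

noncomputable section

open Set

namespace Literature.Analysis.FluidPDE.Tao2016AveragedNS

open Literature.Analysis.FluidPDE.FluidComputer (GadgetSpec)

/-! ## The Tao column of the spec sheet -/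

/-- **Tao's averaged cascade read as a gadget specification** (SPEC-SHEET §3, column "Tao 2016"):
scale ratio `s = 1+ε₀`, seed wavenumber `k0 = (1+ε₀)^{n₀}`, transfer-time law exponent
`alpha = 249/100` and constant `Cplus = 100·(1+ε₀)^{-n₀/100}` (lifespan (6.12) + amplitude drift
(6.11)), efficiency `eta = (1+ε₀)^{-1/50}` ((6.11) squared), forward leakage
`leak = K^{-30}(1+ε₀)^{-10}` ((6.25), `m = 1`), robustness radius `radius = K^{-10}` (conduit tolerance
(6.17)); `amp = dStar = 0` are readings (module docstring). [cite: Tao2016AveragedNS, Prop 6.3] -/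
def taoSpec (ε₀ K : ℝ) (n₀ : ℤ) : GadgetSpec where
  s := 1 + ε₀
  k0 := (1 + ε₀) ^ (n₀ : ℝ)
  alpha := 249 / 100
  Cplus := 100 * (1 + ε₀) ^ (-(n₀ : ℝ) / 100)
  eta := (1 + ε₀) ^ (-(1 : ℝ) / 50)
  leak := (K ^ 30)⁻¹ * (1 + ε₀) ^ (-(10 : ℝ))
  dStar := 0
  amp := 0
  radius := (K ^ 10)⁻¹

section Arithmetic

variable {ε₀ K : ℝ} {n₀ : ℤ}

/-- Field projection of `taoSpec` (definitional): scale ratio `s = 1+ε₀`.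
[cite: Tao2016AveragedNS, Prop 6.3] -/
@[simp] theorem taoSpec_s : (taoSpec ε₀ K n₀).s = 1 + ε₀ := rfl
/-- Field projection of `taoSpec` (definitional): seed wavenumber `k0 = (1+ε₀)^{n₀}`.
[cite: Tao2016AveragedNS, Prop 6.3] -/
@[simp] theorem taoSpec_k0 : (taoSpec ε₀ K n₀).k0 = (1 + ε₀) ^ (n₀ : ℝ) := rfl
/-- Field projection of `taoSpec` (definitional): transfer-time exponent `alpha = 249/100`.
[cite: Tao2016AveragedNS, Prop 6.3] -/
@[simp] theorem taoSpec_alpha : (taoSpec ε₀ K n₀).alpha = 249 / 100 := rfl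
/-- Field projection of `taoSpec` (definitional): transfer-time constant `Cplus = 100·(1+ε₀)^{-n₀/100}`.
[cite: Tao2016AveragedNS, Prop 6.3] -/
@[simp] theorem taoSpec_Cplus : (taoSpec ε₀ K n₀).Cplus = 100 * (1 + ε₀) ^ (-(n₀ : ℝ) / 100) := rfl
/-- Field projection of `taoSpec` (definitional): efficiency `eta = (1+ε₀)^{-1/50}`.
[cite: Tao2016AveragedNS, Prop 6.3] -/
@[simp] theorem taoSpec_eta : (taoSpec ε₀ K n₀).eta = (1 + ε₀) ^ (-(1 : ℝ) / 50) := rfl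
/-- Field projection of `taoSpec` (definitional): forward leakage `leak = K^{-30}(1+ε₀)^{-10}`.
[cite: Tao2016AveragedNS, Prop 6.3] -/
@[simp] theorem taoSpec_leak :
    (taoSpec ε₀ K n₀).leak = (K ^ 30)⁻¹ * (1 + ε₀) ^ (-(10 : ℝ)) := rfl
/-- Field projection of `taoSpec` (definitional): dissipation allowance `dStar = 0` (a reading).
[cite: Tao2016AveragedNS, Prop 6.3] -/
@[simp] theorem taoSpec_dStar : (taoSpec ε₀ K n₀).dStar = 0 := rfl
/-- Field projection of `taoSpec` (definitional): noise amplification `amp = 0` (a reading).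
[cite: Tao2016AveragedNS, Prop 6.3] -/
@[simp] theorem taoSpec_amp : (taoSpec ε₀ K n₀).amp = 0 := rfl
/-- Field projection of `taoSpec` (definitional): robustness radius `radius = K^{-10}`.
[cite: Tao2016AveragedNS, Prop 6.3] -/
@[simp] theorem taoSpec_radius : (taoSpec ε₀ K n₀).radius = (K ^ 10)⁻¹ := rfl

/-- The sign conditions `GadgetSpec.Valid` hold for the Tao column (`ε₀ > 0`, `K > 0`).
[cite: Tao2016AveragedNS, Prop 6.3] -/
theorem taoSpec_valid (hε₀ : 0 < ε₀) (hK : 0 < K) : (taoSpec ε₀ K n₀).Valid where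
  one_lt_s := by simp only [taoSpec_s]; linarith
  k0_pos := Real.rpow_pos_of_pos (by linarith) _
  alpha_pos := by simp only [taoSpec_alpha]; norm_num
  Cplus_nonneg := by
    simp only [taoSpec_Cplus]
    exact mul_nonneg (by norm_num) (Real.rpow_pos_of_pos (by linarith) _).le
  eta_pos := Real.rpow_pos_of_pos (by linarith) _
  leak_nonneg := by
    simp only [taoSpec_leak]
    exact mul_nonneg (inv_nonneg.2 (pow_nonneg hK.le 30)) (Real.rpow_pos_of_pos (by linarith) _).le
  dStar_nonneg := le_rfl
  amp_nonneg := le_rfl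
  radius_pos := by simp only [taoSpec_radius]; exact inv_pos.2 (pow_pos hK 10)

/-- SPEC-SHEET §2 (B) for the Tao column: `alpha = 5/2 - 1/100 > 2` — the per-level viscous loss
bound does not grow with the level (`GadgetSpec.viscousLoss_le` applies).
[cite: Tao2016AveragedNS, Prop 6.3 (6.11)–(6.12)] -/
theorem taoSpec_two_lt_alpha : 2 < (taoSpec ε₀ K n₀).alpha := by
  simp only [taoSpec_alpha]; norm_num

/-- SPEC-SHEET §2 (D) for the Tao column: `s⁻¹ = (1+ε₀)^{-1} < (1+ε₀)^{-1/50} = eta` — Tao's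
cascade keeps far more than the critical fraction `1/s` of the level energy per step.
[cite: Tao2016AveragedNS, Prop 6.3 (6.11)] -/
theorem taoSpec_inv_s_lt_eta (hε₀ : 0 < ε₀) : (taoSpec ε₀ K n₀).s⁻¹ < (taoSpec ε₀ K n₀).eta := by
  simp only [taoSpec_s, taoSpec_eta]
  rw [← Real.rpow_neg_one]
  exact Real.rpow_lt_rpow_of_exponent_lt (by linarith) (by norm_num)

/-- SPEC-SHEET §2 (D), dimensional form: the Tao column has `alphaEff > 2`
(`GadgetSpec.two_lt_alphaEff_iff`). [cite: Tao2016AveragedNS, Prop 6.3 (6.11)] -/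
theorem taoSpec_two_lt_alphaEff (hε₀ : 0 < ε₀) : 2 < (taoSpec ε₀ K n₀).alphaEff :=
  (GadgetSpec.two_lt_alphaEff_iff (by simp only [taoSpec_s]; linarith)
    (Real.rpow_pos_of_pos (by linarith) _)).2 (taoSpec_inv_s_lt_eta hε₀)

/-- SPEC-SHEET §2 (E) for the Tao column: `1 < s³·eta = (1+ε₀)^{3 - 1/50}`, the growth factor per
level of `k³ ·` level energy (the squared local-velocity floor). [cite: Tao2016AveragedNS, Prop 6.3 (6.11)] -/
theorem taoSpec_one_lt_cube_mul_eta (hε₀ : 0 < ε₀) :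
    1 < (taoSpec ε₀ K n₀).s ^ 3 * (taoSpec ε₀ K n₀).eta :=
  GadgetSpec.one_lt_cube_mul_eta (by simp only [taoSpec_s]; linarith)
    (Real.rpow_pos_of_pos (by linarith) _) (taoSpec_inv_s_lt_eta hε₀)

/-- SPEC-SHEET §2 (C) for the Tao column, in the degenerate reading `amp = dStar = 0` (module
docstring): `leak = K^{-30}(1+ε₀)^{-10} ≤ (1+ε₀)^{-1/50}·K^{-10} = eta·radius` for `K ≥ 1`. This is
NOT Tao's robustness statement (Prop. 6.4 reproduces fixed, mode-dependent tolerances); it records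
only that the one-radius bookkeeping closes trivially on his numbers. [folklore] -/
theorem taoSpec_closure (hε₀ : 0 < ε₀) (hK : 1 ≤ K) : (taoSpec ε₀ K n₀).Closure where
  le := by
    simp only [taoSpec_amp, taoSpec_radius, taoSpec_leak, taoSpec_dStar, taoSpec_eta, zero_mul,
      zero_add, add_zero]
    have hK0 : 0 < K := lt_of_lt_of_le one_pos hK
    have h1 : (K ^ 30)⁻¹ ≤ (K ^ 10)⁻¹ :=
      inv_anti₀ (pow_pos hK0 10) (pow_le_pow_right₀ hK (by norm_num))
    have h2 : (1 + ε₀) ^ (-(10 : ℝ)) ≤ (1 + ε₀) ^ (-(1 : ℝ) / 50) :=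
      Real.rpow_le_rpow_of_exponent_le (by linarith) (by norm_num)
    calc (K ^ 30)⁻¹ * (1 + ε₀) ^ (-(10 : ℝ))
        ≤ (K ^ 10)⁻¹ * (1 + ε₀) ^ (-(1 : ℝ) / 50) :=
          mul_le_mul h1 h2 (Real.rpow_pos_of_pos (by linarith) _).le
            (inv_nonneg.2 (pow_nonneg hK0.le 10))
      _ = (1 + ε₀) ^ (-(1 : ℝ) / 50) * (K ^ 10)⁻¹ := mul_comm _ _

/-- Level wavenumbers of the Tao column: `k_m = (1+ε₀)^{n₀} (1+ε₀)^m = (1+ε₀)^{n₀+m}`, the frequency of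
Tao's scale `n = n₀ + m` (Def. 3.1). [cite: Tao2016AveragedNS, Def 3.1] -/
theorem taoSpec_k (hε₀ : 0 < ε₀) (m : ℕ) :
    (taoSpec ε₀ K n₀).k m = (1 + ε₀) ^ ((n₀ : ℝ) + m) := by
  have h0 : (0 : ℝ) < 1 + ε₀ := by linarith
  unfold GadgetSpec.k
  simp only [taoSpec_k0, taoSpec_s]
  rw [← Real.rpow_natCast (1 + ε₀) m, ← Real.rpow_add h0]

/-- The transfer-time allowance of the Tao column in closed form:
`Tmax m = 100·(1+ε₀)^{-5n₀/2}·(1+ε₀)^{-(249/100)·m}`. [cite: Tao2016AveragedNS, Prop 6.3 (6.12)] -/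
theorem taoSpec_Tmax (hε₀ : 0 < ε₀) (m : ℕ) :
    (taoSpec ε₀ K n₀).Tmax m =
      100 * (1 + ε₀) ^ (-(5 : ℝ) * n₀ / 2) * (1 + ε₀) ^ (-(249 : ℝ) / 100 * m) := by
  have h0 : (0 : ℝ) < 1 + ε₀ := by linarith
  unfold GadgetSpec.Tmax
  rw [taoSpec_k hε₀ m]
  simp only [taoSpec_Cplus, taoSpec_alpha]
  rw [← Real.rpow_mul h0.le, mul_assoc, ← Real.rpow_add h0, mul_assoc, ← Real.rpow_add h0]
  congr 1
  congr 1
  ring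

/-- The horizon of the Tao column in closed form:
`horizon = 100·(1+ε₀)^{-5n₀/2} / (1 - (1+ε₀)^{-249/100})` — literally the uniform bound `T_{ε₀}` of
the in-tree `TaoCascade.BlowupCheckpoints.time_le_uniform` (Tao p. 32).
[cite: Tao2016AveragedNS, §6.2 p. 32] -/
theorem taoSpec_horizon (hε₀ : 0 < ε₀) :
    (taoSpec ε₀ K n₀).horizon =
      100 * (1 + ε₀) ^ (-(5 : ℝ) * n₀ / 2) / (1 - (1 + ε₀) ^ (-(249 : ℝ) / 100)) := by
  have h0 : (0 : ℝ) < 1 + ε₀ := by linarith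
  unfold GadgetSpec.horizon
  simp only [taoSpec_Cplus, taoSpec_k0, taoSpec_alpha, taoSpec_s]
  rw [← Real.rpow_mul h0.le, mul_assoc, ← Real.rpow_add h0]
  have hexp : -(n₀ : ℝ) / 100 + (n₀ : ℝ) * -(249 / 100 : ℝ) = -(5 : ℝ) * n₀ / 2 := by ring
  have hexp' : (-(249 / 100 : ℝ)) = -(249 : ℝ) / 100 := by norm_num
  rw [hexp, hexp']

end Arithmetic

/-! ## The dictionary theorems: Prop. 6.3's checkpoints meet the spec -/

section Checkpoints

variable {ε₀ K ε : ℝ} {n₀ N : ℤ} {X : Fin 4 → ℤ → ℝ → ℝ} {E : ℤ → ℝ → ℝ} {t e : ℤ → ℝ}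

/-- Deterministic upper envelope of the lifespan: `t_{n+1} - t_n ≤ 100(1+ε₀)^{-5n₀/2}(1+ε₀)^{-(249/100)(n-n₀)}`
for `n₀ ≤ n < N` ((6.12) upper and `e_n ≥ (1+ε₀)^{-(n-n₀)/100}`; the computation of Tao p. 32, as in
the in-tree `BlowupCheckpoints.time_le`). [cite: Tao2016AveragedNS, Prop 6.3 (6.11)–(6.12)] -/
theorem lifespan_le_geometric (h : TaoCascade.BlowupCheckpoints ε₀ K ε n₀ N X E t e) (hε₀ : 0 < ε₀)
    {n : ℤ} (hn₀ : n₀ ≤ n) (hnN : n + 1 ≤ N) :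
    t (n + 1) - t n ≤
      100 * (1 + ε₀) ^ (-(5 : ℝ) * n₀ / 2) * (1 + ε₀) ^ (-(249 : ℝ) / 100 * (n - n₀)) := by
  have h0 : (0 : ℝ) < 1 + ε₀ := by linarith
  have hs := h.step (n + 1) (by omega) hnN
  have hlife := hs.life_le
  simp only [add_sub_cancel_right] at hlife
  have hcast : (((n + 1 : ℤ) : ℝ) - 1) = (n : ℝ) := by push_cast; ring
  rw [hcast] at hlife
  have hen : (1 + ε₀) ^ (-((n : ℝ) - n₀) / 100) ≤ e n := h.rpow_le_amp hε₀ hn₀ (by omega)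
  have hinv : (e n)⁻¹ ≤ (1 + ε₀) ^ (((n : ℝ) - n₀) / 100) := by
    have hpos : 0 < (1 + ε₀) ^ (-((n : ℝ) - n₀) / 100) := Real.rpow_pos_of_pos h0 _
    calc (e n)⁻¹ ≤ ((1 + ε₀) ^ (-((n : ℝ) - n₀) / 100))⁻¹ := inv_anti₀ hpos hen
      _ = (1 + ε₀) ^ (((n : ℝ) - n₀) / 100) := by
          rw [← Real.rpow_neg h0.le]; congr 1; ring
  calc t (n + 1) - t n ≤ 100 * (1 + ε₀) ^ (-(5 : ℝ) * n / 2) * (e n)⁻¹ := hlife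
    _ ≤ 100 * (1 + ε₀) ^ (-(5 : ℝ) * n / 2) * (1 + ε₀) ^ (((n : ℝ) - n₀) / 100) := by gcongr
    _ = 100 * (1 + ε₀) ^ (-(5 : ℝ) * n₀ / 2) * (1 + ε₀) ^ (-(249 : ℝ) / 100 * (n - n₀)) := by
        have hexp : -(5 : ℝ) * n / 2 + ((n : ℝ) - n₀) / 100 =
            -(5 : ℝ) * n₀ / 2 + -(249 : ℝ) / 100 * (n - n₀) := by ring
        rw [mul_assoc, mul_assoc, ← Real.rpow_add h0, ← Real.rpow_add h0, hexp]

/-- Deterministic lower envelope of the lifespan: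
`(1/100)(1+ε₀)^{-5n₀/2}(1+ε₀)^{-(251/100)(n-n₀)} ≤ t_{n+1} - t_n` for `n₀ ≤ n < N` ((6.12) lower and
`e_n ≤ (1+ε₀)^{(n-n₀)/100}`). With `lifespan_le_geometric`: the dimensionless transfer time is
level-independent up to the factor `10^{±2}` of (6.12) and the amplitude drift `(1+ε₀)^{∓(n-n₀)/100}`
(SPEC-SHEET key `tau_spread`). [cite: Tao2016AveragedNS, Prop 6.3 (6.11)–(6.12)] -/
theorem lifespan_ge_geometric (h : TaoCascade.BlowupCheckpoints ε₀ K ε n₀ N X E t e) (hε₀ : 0 < ε₀)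
    {n : ℤ} (hn₀ : n₀ ≤ n) (hnN : n + 1 ≤ N) :
    1 / 100 * (1 + ε₀) ^ (-(5 : ℝ) * n₀ / 2) * (1 + ε₀) ^ (-(251 : ℝ) / 100 * (n - n₀)) ≤
      t (n + 1) - t n := by
  have h0 : (0 : ℝ) < 1 + ε₀ := by linarith
  have hs := h.step (n + 1) (by omega) hnN
  have hlife := hs.life_ge
  simp only [add_sub_cancel_right] at hlife
  have hcast : (((n + 1 : ℤ) : ℝ) - 1) = (n : ℝ) := by push_cast; ring
  rw [hcast] at hlife
  have hen : e n ≤ (1 + ε₀) ^ (((n : ℝ) - n₀) / 100) := h.amp_le_rpow hε₀ hn₀ (by omega)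
  have hepos : 0 < e n := h.amp_pos hn₀ (by omega)
  have hinv : (1 + ε₀) ^ (-((n : ℝ) - n₀) / 100) ≤ (e n)⁻¹ := by
    calc (1 + ε₀) ^ (-((n : ℝ) - n₀) / 100) = ((1 + ε₀) ^ (((n : ℝ) - n₀) / 100))⁻¹ := by
          rw [← Real.rpow_neg h0.le]; congr 1; ring
      _ ≤ (e n)⁻¹ := inv_anti₀ hepos hen
  calc 1 / 100 * (1 + ε₀) ^ (-(5 : ℝ) * n₀ / 2) * (1 + ε₀) ^ (-(251 : ℝ) / 100 * (n - n₀))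
      = 1 / 100 * (1 + ε₀) ^ (-(5 : ℝ) * n / 2) * (1 + ε₀) ^ (-((n : ℝ) - n₀) / 100) := by
        have hexp : -(5 : ℝ) * n₀ / 2 + -(251 : ℝ) / 100 * (n - n₀) =
            -(5 : ℝ) * n / 2 + -((n : ℝ) - n₀) / 100 := by ring
        rw [mul_assoc, mul_assoc, ← Real.rpow_add h0, ← Real.rpow_add h0, hexp]
    _ ≤ 1 / 100 * (1 + ε₀) ^ (-(5 : ℝ) * n / 2) * (e n)⁻¹ := by gcongr
    _ ≤ t (n + 1) - t n := hlife

/-- **Transfer-time law (SPEC-SHEET §1, (A), (B)).** The `m`-th transfer of Tao's cascade takes at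
most `Tmax m = Cplus·k_m^{-alpha}` with `alpha = 249/100 > 2`:
`t_{n₀+m+1} - t_{n₀+m} ≤ (taoSpec ε₀ K n₀).Tmax m`. [cite: Tao2016AveragedNS, Prop 6.3 (6.11)–(6.12)] -/
theorem transferTime_le_Tmax (h : TaoCascade.BlowupCheckpoints ε₀ K ε n₀ N X E t e) (hε₀ : 0 < ε₀)
    (m : ℕ) (hN : n₀ + m + 1 ≤ N) :
    t (n₀ + m + 1) - t (n₀ + m) ≤ (taoSpec ε₀ K n₀).Tmax m := by
  have hmain := lifespan_le_geometric h hε₀ (n := n₀ + m) (by omega) hN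
  have hcast : (((n₀ + m : ℤ) : ℝ) - n₀) = (m : ℝ) := by push_cast; ring
  rw [hcast] at hmain
  rwa [taoSpec_Tmax hε₀ m]

/-- **Efficiency (SPEC-SHEET key `eta`), lower side.** `eta·e_n² ≤ e_{n+1}²` with
`eta = (1+ε₀)^{-1/50}`: at least the fraction `eta` of the level energy is handed on
((6.11), lower, squared). [cite: Tao2016AveragedNS, Prop 6.3 (6.11)] -/
theorem eta_mul_sq_le_sq (h : TaoCascade.BlowupCheckpoints ε₀ K ε n₀ N X E t e) (hε₀ : 0 < ε₀)
    {n : ℤ} (hn₀ : n₀ ≤ n) (hnN : n + 1 ≤ N) :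
    (taoSpec ε₀ K n₀).eta * e n ^ 2 ≤ e (n + 1) ^ 2 := by
  have h0 : (0 : ℝ) < 1 + ε₀ := by linarith
  have hs := h.step (n + 1) (by omega) hnN
  have hamp := hs.amp_ge
  simp only [add_sub_cancel_right] at hamp
  have hq : 0 < (1 + ε₀) ^ (-(1 : ℝ) / 100) := Real.rpow_pos_of_pos h0 _
  have hepos : 0 < e n := h.amp_pos hn₀ (by omega)
  have hsq : ((1 + ε₀) ^ (-(1 : ℝ) / 100) * e n) ^ 2 ≤ e (n + 1) ^ 2 :=
    pow_le_pow_left₀ (mul_nonneg hq.le hepos.le) hamp 2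
  have heta : ((1 + ε₀) ^ (-(1 : ℝ) / 100)) ^ 2 = (1 + ε₀) ^ (-(1 : ℝ) / 50) := by
    rw [← Real.rpow_natCast ((1 + ε₀) ^ (-(1 : ℝ) / 100)) 2, ← Real.rpow_mul h0.le]
    norm_num
  simp only [taoSpec_eta]
  calc (1 + ε₀) ^ (-(1 : ℝ) / 50) * e n ^ 2 = ((1 + ε₀) ^ (-(1 : ℝ) / 100) * e n) ^ 2 := by
        rw [mul_pow, heta]
    _ ≤ e (n + 1) ^ 2 := hsq

/-- **Efficiency, upper side.** `e_{n+1}² ≤ e_n²/eta` ((6.11), upper, squared): the amplitude may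
also drift UP by at most `(1+ε₀)^{1/100}` per level (SPEC-SHEET key `eta_spread`).
[cite: Tao2016AveragedNS, Prop 6.3 (6.11)] -/
theorem sq_le_sq_div_eta (h : TaoCascade.BlowupCheckpoints ε₀ K ε n₀ N X E t e) (hε₀ : 0 < ε₀)
    {n : ℤ} (hn₀ : n₀ ≤ n) (hnN : n + 1 ≤ N) :
    e (n + 1) ^ 2 ≤ e n ^ 2 / (taoSpec ε₀ K n₀).eta := by
  have h0 : (0 : ℝ) < 1 + ε₀ := by linarith
  have hs := h.step (n + 1) (by omega) hnN
  have hamp := hs.amp_le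
  simp only [add_sub_cancel_right] at hamp
  have hq : 0 < (1 + ε₀) ^ ((1 : ℝ) / 100) := Real.rpow_pos_of_pos h0 _
  have hepos : 0 < e (n + 1) := h.amp_pos (by omega) hnN
  have hsq : e (n + 1) ^ 2 ≤ ((1 + ε₀) ^ ((1 : ℝ) / 100) * e n) ^ 2 :=
    pow_le_pow_left₀ hepos.le hamp 2
  have heta : ((1 + ε₀) ^ ((1 : ℝ) / 100)) ^ 2 = ((1 + ε₀) ^ (-(1 : ℝ) / 50))⁻¹ := by
    rw [← Real.rpow_natCast ((1 + ε₀) ^ ((1 : ℝ) / 100)) 2, ← Real.rpow_mul h0.le,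
      ← Real.rpow_neg h0.le]
    norm_num
  simp only [taoSpec_eta]
  calc e (n + 1) ^ 2 ≤ ((1 + ε₀) ^ ((1 : ℝ) / 100) * e n) ^ 2 := hsq
    _ = e n ^ 2 / (1 + ε₀) ^ (-(1 : ℝ) / 50) := by
        rw [mul_pow, heta]; ring

/-- **Energy ladder (SPEC-SHEET `E_n ≥ eta^n E_0`).** `eta^m ≤ e_{n₀+m}²` for `n₀ + m ≤ N`
(`e_{n₀} = 1` (6.10) and (6.11)). [cite: Tao2016AveragedNS, Prop 6.3 (6.10)–(6.11)] -/
theorem eta_pow_le_sq (h : TaoCascade.BlowupCheckpoints ε₀ K ε n₀ N X E t e) (hε₀ : 0 < ε₀)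
    (m : ℕ) (hN : n₀ + m ≤ N) :
    (taoSpec ε₀ K n₀).eta ^ m ≤ e (n₀ + m) ^ 2 := by
  have h0 : (0 : ℝ) < 1 + ε₀ := by linarith
  have hen : (1 + ε₀) ^ (-(((n₀ + m : ℤ) : ℝ) - n₀) / 100) ≤ e (n₀ + m) :=
    h.rpow_le_amp hε₀ (by omega) hN
  have hcast : (-(((n₀ + m : ℤ) : ℝ) - n₀) / 100) = -(m : ℝ) / 100 := by push_cast; ring
  rw [hcast] at hen
  have hq : 0 < (1 + ε₀) ^ (-(m : ℝ) / 100) := Real.rpow_pos_of_pos h0 _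
  have hsq : ((1 + ε₀) ^ (-(m : ℝ) / 100)) ^ 2 ≤ e (n₀ + m) ^ 2 := pow_le_pow_left₀ hq.le hen 2
  have heta : (taoSpec ε₀ K n₀).eta ^ m = ((1 + ε₀) ^ (-(m : ℝ) / 100)) ^ 2 := by
    simp only [taoSpec_eta]
    rw [← Real.rpow_natCast ((1 + ε₀) ^ (-(1 : ℝ) / 50)) m, ← Real.rpow_mul h0.le,
      ← Real.rpow_natCast ((1 + ε₀) ^ (-(m : ℝ) / 100)) 2, ← Real.rpow_mul h0.le]
    congr 1
    push_cast
    ring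
  rw [heta]
  exact hsq

/-- **Forward leakage (SPEC-SHEET key `leak` = `L_fwd`).** During the step `n-1 → n`
(`t ∈ [t_{n-1}, t_n]`) the energy already one level BEYOND the output level obeys
`E_{n+1}(t) ≤ leak · e_{n-1}²`, `leak = K^{-30}(1+ε₀)^{-10}` ((6.25), `m = 1`).
[cite: Tao2016AveragedNS, Prop 6.3 (6.25)] -/
theorem forwardLeak_le (h : TaoCascade.BlowupCheckpoints ε₀ K ε n₀ N X E t e)
    {n : ℤ} (hn₀ : n₀ < n) (hnN : n ≤ N) {t' : ℝ} (ht' : t' ∈ Icc (t (n - 1)) (t n)) :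
    E (n + 1) t' ≤ (taoSpec ε₀ K n₀).leak * e (n - 1) ^ 2 := by
  have hs := h.step n hn₀ hnN
  have hleak := hs.en_after 1 le_rfl t' ht'
  simp only [Nat.cast_one, mul_one] at hleak
  simpa only [taoSpec_leak] using hleak

/-- **Transition-state tolerance ↔ robustness radius (SPEC-SHEET key `radius`).** The conduit mode
is within `radius · e_n` of zero at every checkpoint: `|X_{4,n}(t_n)| ≤ K^{-10} e_n` ((6.17)). (The
trigger tolerances (6.14)–(6.15) are finer and mode-dependent; module docstring.)
[cite: Tao2016AveragedNS, Prop 6.3 (6.17)] -/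
theorem conduit_residual_le (h : TaoCascade.BlowupCheckpoints ε₀ K ε n₀ N X E t e)
    {n : ℤ} (hn₀ : n₀ ≤ n) (hnN : n ≤ N) :
    |X 3 n (t n)| ≤ (taoSpec ε₀ K n₀).radius * e n := by
  simpa only [taoSpec_radius] using (h.state n hn₀ hnN).x4_abs_le

/-- **Finite horizon (SPEC-SHEET §2 (A)).** Every checkpoint time satisfies
`0 ≤ t_n ≤ horizon = Cplus·k0^{-alpha}/(1 - s^{-alpha})` of the Tao column — Tao's
"`t_N ≤ T_{ε₀}` independent of `N`" (p. 32) is the spec sheet's horizon on the nose.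
[cite: Tao2016AveragedNS, §6.2 p. 32] -/
theorem checkpoint_le_horizon (h : TaoCascade.BlowupCheckpoints ε₀ K ε n₀ N X E t e) (hε₀ : 0 < ε₀)
    {n : ℤ} (hn₀ : n₀ ≤ n) (hnN : n ≤ N) :
    0 ≤ t n ∧ t n ≤ (taoSpec ε₀ K n₀).horizon := by
  rw [taoSpec_horizon hε₀]
  exact h.time_le_uniform hε₀ hn₀ hnN

end Checkpoints

/-! ## Under the quantifiers of Prop. 6.3 (the named fact `TaoCascade.blowupDynamics`) -/

/-- **Prop. 6.3 ⟹ Tao's cascade is on-spec at every level.** Under the named fact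
`TaoCascade.blowupDynamics` (Prop. 6.3, taken as a hypothesis — not asserted), for every `ε₀ ∈ (0,1)`,
`K` large, `ε` small, implied constants `C₁, C₂ ≥ 0` and `n₀` large, every solution of the cascade
system (6.0)–(6.8) admits, up to any level `N`, checkpoints whose transfer times obey the law
`T_m ≤ Tmax m` (`alpha = 249/100`), whose level energies obey `eta·e_n² ≤ e_{n+1}²`
(`eta = (1+ε₀)^{-1/50}`), and which all occur before the finite horizon of `taoSpec ε₀ K n₀`.
[cite: Tao2016AveragedNS, Prop 6.3] -/
theorem blowupDynamics_onSpec (hdyn : TaoCascade.blowupDynamics) {ε₀ : ℝ} (hε₀ : 0 < ε₀)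
    (hε₀1 : ε₀ < 1) :
    ∃ K₀ : ℝ, ∀ K : ℝ, K₀ ≤ K → 0 < K →
      ∃ e₀ : ℝ, 0 < e₀ ∧ ∀ ε : ℝ, 0 < ε → ε ≤ e₀ →
        ∀ C₁ C₂ : ℝ, 0 ≤ C₁ → 0 ≤ C₂ →
          ∃ N₀ : ℤ, ∀ n₀ : ℤ, N₀ ≤ n₀ →
            ∀ (X : Fin 4 → ℤ → ℝ → ℝ) (E : ℤ → ℝ → ℝ),
              TaoCascade.TaoODESystem ε₀ K ε C₁ C₂ n₀ X E →
              ∀ N : ℤ, n₀ ≤ N → ∃ t e : ℤ → ℝ,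
                (∀ m : ℕ, n₀ + m + 1 ≤ N →
                    t (n₀ + m + 1) - t (n₀ + m) ≤ (taoSpec ε₀ K n₀).Tmax m ∧
                      (taoSpec ε₀ K n₀).eta * e (n₀ + m) ^ 2 ≤ e (n₀ + m + 1) ^ 2) ∧
                (∀ m : ℕ, n₀ + m ≤ N →
                    (taoSpec ε₀ K n₀).eta ^ m ≤ e (n₀ + m) ^ 2 ∧
                      0 ≤ t (n₀ + m) ∧ t (n₀ + m) ≤ (taoSpec ε₀ K n₀).horizon) := by
  obtain ⟨K₀, hK⟩ := hdyn ε₀ hε₀ hε₀1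
  refine ⟨K₀, fun K hK₀ hKpos => ?_⟩
  obtain ⟨e₀, he₀, hε⟩ := hK K hK₀ hKpos
  refine ⟨e₀, he₀, fun ε hε1 hε2 C₁ C₂ hC₁ hC₂ => ?_⟩
  obtain ⟨N₀, hN⟩ := hε ε hε1 hε2 C₁ C₂ hC₁ hC₂
  refine ⟨N₀, fun n₀ hn₀ X E hsys N hNn => ?_⟩
  obtain ⟨t, e, hcp⟩ := hN n₀ hn₀ X E hsys N hNn
  refine ⟨t, e, fun m hm => ⟨transferTime_le_Tmax hcp hε₀ m hm, ?_⟩, fun m hm => ⟨?_, ?_⟩⟩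
  · exact eta_mul_sq_le_sq hcp hε₀ (n := n₀ + m) (by omega) hm
  · exact eta_pow_le_sq hcp hε₀ m hm
  · exact checkpoint_le_horizon hcp hε₀ (n := n₀ + m) (by omega) hm

end Literature.Analysis.FluidPDE.Tao2016AveragedNS
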